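import Mathlib.Analysis.SpecialFunctions.Pow.Real
import Summits.MatrixMultiplication.MatrixMultiplication.Theses.GroupTheoreticSTPP
import Literature.Computability.AlgebraicComplexity.PrattTrapezoidValSDPP

set_option linter.dupNamespace false

/-!
# Stub `stub_packingToCThesis` — two families certify X_C (`CPackingConstruction → CThesis`)

Crux `stmt-MatrixMultiplication-10595` (`Theses.ThinBlockAlpha.ThinPackings`), line
`two-families-salem-spencer`, registered stub `stub_packingToCThesis : CPackingConstruction → CThesis`
(siege k8, variation: certificate on the finite core — the only non-structural content is ONE explicit
exponent certificate `δ := ε / (6 + ε)`, `δ · (6 + ε) = ε`, and ONE explicit threshold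
`n ≥ ⌈64^{1/ε}⌉₊ + 2`).

The mathematics is the Cohn–Kleinberg–Szegedy–Umans triangle lift (CKSU 2005 §6.2; Pratt 2024, proof of
Thm. 4.7), every ingredient of which is PROVED in the tree
(`Literature.Computability.AlgebraicComplexity.PrattTrapezoidValSDPP`):

* from `CPackingConstruction` at parameter `δ` take `n` pairs `(A i, B i)` in a finite abelian group `H`
  with the simultaneous double product property, `|H| ≤ n^{2+δ}`, `|A i| |B i| ≥ n^{2-δ}`;
* take a corner-free index configuration `j₁ j₂ j₃ : ι₀ → Fin n` with `n^{2-δ} ≤ 64 |ι₀|`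
  (`exists_cornerFree_indexMaps_card_ge`, Behrend);
* the lift `(A (j₁ x) × {0} × B (j₃ x), B (j₁ x) × A (j₂ x) × {0}, {0} × B (j₂ x) × A (j₃ x))_{x ∈ ι₀}`
  is an STPP family in `H × H × H` (`addSimultaneousTPP_of_sdpp` + `addSimultaneousTPP_iff_forall`),
  re-indexed by `Fin |ι₀|` through `Fintype.equivFin`;
* counting: every block has volume `∏_t |A (j_t x)| |B (j_t x)| ≥ n^{3(2-δ)}`, so
  `Σ_x vol_x^{(2+ε)/3} ≥ |ι₀| · n^{(2-δ)(2+ε)} ≥ n^{2-δ} · n^{(2-δ)(2+ε)} / 64 = n^{3(2+δ)+ε} / 64`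
  (this is where `δ (6 + ε) = ε` is used), and `n^ε > 64` because `n > 64^{1/ε}`; finally
  `|H × H × H| = |H|³ ≤ n^{3(2+δ)}`.

[cite: CohnKleinbergSzegedyUmans2005 (arXiv:math/0511460), §6.2]
[cite: Pratt2024 (arXiv:2309.03878), Thm. 4.7 (proof)]
-/

namespace Summit.MatrixMultiplication.MatrixMultiplication.Theorems.ThinPackings.PackingToCThesisK8

open Finset
open Summit.MatrixMultiplication.MatrixMultiplication.Theses.GroupTheoreticSTPP
  (CPackingConstruction CThesis)
open Literature.Computability.AlgebraicComplexity
  (addSimultaneousTPP_of_sdpp card_mul_card_mul_card_sdpp exists_cornerFree_indexMaps_card_ge)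
open Literature.Combinatorics.Additive (addSimultaneousTPP_iff_forall)

/-- **Exponent certificate.** For `ε > 0` the number `δ := ε / (6 + ε)` satisfies `0 < δ ≤ 1` and
`δ (6 + ε) = ε`; these three facts are all the proof of `stub_packingToCThesis` uses about `δ`. -/
theorem exponent_certificate {ε : ℝ} (hε : 0 < ε) :
    ∃ δ : ℝ, 0 < δ ∧ δ ≤ 1 ∧ δ * (6 + ε) = ε := by
  have h6 : (0 : ℝ) < 6 + ε := by linarith
  refine ⟨ε / (6 + ε), div_pos hε h6, ?_, div_mul_cancel₀ ε h6.ne'⟩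
  rw [div_le_one h6]
  linarith

/-- **Threshold certificate.** If `⌈64^{1/ε}⌉₊ + 2 ≤ n` then `64 < n^ε` (and `2 ≤ n`). -/
theorem threshold_certificate {ε : ℝ} (hε : 0 < ε) {n : ℕ} (hn : ⌈(64 : ℝ) ^ ε⁻¹⌉₊ + 2 ≤ n) :
    (64 : ℝ) < (n : ℝ) ^ ε := by
  have hlt : (64 : ℝ) ^ ε⁻¹ < n :=
    calc (64 : ℝ) ^ ε⁻¹ ≤ ⌈(64 : ℝ) ^ ε⁻¹⌉₊ := Nat.le_ceil _
      _ < n := by exact_mod_cast (show ⌈(64 : ℝ) ^ ε⁻¹⌉₊ < n by omega)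
  have h := Real.rpow_lt_rpow (Real.rpow_nonneg (by norm_num) _) hlt hε
  rwa [Real.rpow_inv_rpow (by norm_num) hε.ne'] at h

/-- A product of three naturals each at least `Y ≥ 0` (as reals) is at least `Y · Y · Y`. -/
theorem cube_le_cast_mul₃ {Y : ℝ} {p₁ p₂ p₃ : ℕ} (hY : 0 ≤ Y) (h₁ : Y ≤ (p₁ : ℝ))
    (h₂ : Y ≤ (p₂ : ℝ)) (h₃ : Y ≤ (p₃ : ℝ)) : Y * Y * Y ≤ ((p₁ * p₂ * p₃ : ℕ) : ℝ) := by
  push_cast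
  exact mul_le_mul (mul_le_mul h₁ h₂ hY (Nat.cast_nonneg _)) h₃ hY (by positivity)

/-- **stub_packingToCThesis** — TWO FAMILIES CERTIFY X_C.  CKSU Conjecture 4.7
(`GroupTheoreticSTPP.CPackingConstruction`, item stmt-MatrixMultiplication-0595) implies the abelian
STPP thesis X_C (`GroupTheoreticSTPP.CThesis`, stmt-MatrixMultiplication-0593): lift the SDPP pairs over
a Behrend corner-free index set to an STPP family in `H³` (CKSU 2005 §6.2 / Pratt 2024 Thm. 4.7, tree
theorems `addSimultaneousTPP_of_sdpp`, `exists_cornerFree_indexMaps_card_ge`) and count with the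
certificate `δ = ε/(6+ε)`.  Registered stub of crux stmt-MatrixMultiplication-10595 (line
`two-families-salem-spencer`); also the sufficiency glue of route GroupTheoreticSTPP.
[cite: CohnKleinbergSzegedyUmans2005, §6.2] [cite: Pratt2024, Thm. 4.7 (proof)] -/
theorem stub_packingToCThesis : CPackingConstruction → CThesis := by
  intro hP ε hε
  -- the two certificates
  obtain ⟨δ, hδ, hδ1, hδε⟩ := exponent_certificate hε
  obtain ⟨n₁, hn₁⟩ := exists_cornerFree_indexMaps_card_ge δ hδ hδ1
  -- the SDPP design and the corner-free index configuration
  obtain ⟨n, hn, H, _, _, A, B, hD, hSD, hH, hAB⟩ := hP δ hδ (max n₁ (⌈(64 : ℝ) ^ ε⁻¹⌉₊ + 2))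
  have hnM : ⌈(64 : ℝ) ^ ε⁻¹⌉₊ + 2 ≤ n := le_trans (le_max_right _ _) hn
  obtain ⟨ι₀, _, _, j₁, j₂, j₃, hcard, hcf⟩ := hn₁ n (le_trans (le_max_left _ _) hn)
  -- the CKSU lift is an STPP family (one-clause form)
  have hT := (addSimultaneousTPP_iff_forall _ _ _).1 (addSimultaneousTPP_of_sdpp hD hSD j₁ j₂ j₃ hcf)
  set e := Fintype.equivFin ι₀ with he
  refine ⟨H × H × H, inferInstance, inferInstance, Fintype.card ι₀,
    fun i => A (j₁ (e.symm i)) ×ˢ (({0} : Finset H) ×ˢ B (j₃ (e.symm i))),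
    fun i => B (j₁ (e.symm i)) ×ˢ (A (j₂ (e.symm i)) ×ˢ ({0} : Finset H)),
    fun i => ({0} : Finset H) ×ˢ (B (j₂ (e.symm i)) ×ˢ A (j₃ (e.symm i))), ?_, ?_⟩
  · intro i j k s hs s' hs' t ht t' ht' u hu u' hu' hrel
    obtain ⟨h1, h2, h3, h4, h5⟩ :=
      hT (e.symm i) (e.symm j) (e.symm k) s hs s' hs' t ht t' ht' u hu u' hu' hrel
    exact ⟨e.symm.injective h1, e.symm.injective h2, h3, h4, h5⟩
  · -- counting
    have hn2 : (2 : ℝ) ≤ n := by exact_mod_cast (show 2 ≤ n by omega)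
    have hn0 : (0 : ℝ) < n := by linarith
    have h64 : (64 : ℝ) < (n : ℝ) ^ ε := threshold_certificate hε hnM
    have hY0 : (0 : ℝ) ≤ (n : ℝ) ^ (2 - δ) := Real.rpow_nonneg hn0.le _
    have hX0 : (0 : ℝ) ≤ (n : ℝ) ^ (2 + δ) := Real.rpow_nonneg hn0.le _
    -- every block of the lift has volume^{(2+ε)/3} ≥ n^{(2-δ)(2+ε)}
    have hterm : ∀ x : ι₀, (n : ℝ) ^ ((2 - δ) * (2 + ε)) ≤
        ((#(A (j₁ x) ×ˢ (({0} : Finset H) ×ˢ B (j₃ x))) *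
            #(B (j₁ x) ×ˢ (A (j₂ x) ×ˢ ({0} : Finset H))) *
            #(({0} : Finset H) ×ˢ (B (j₂ x) ×ˢ A (j₃ x))) : ℕ) : ℝ) ^ ((2 + ε) / 3) := by
      intro x
      rw [card_mul_card_mul_card_sdpp j₁ j₂ j₃ x]
      have hle : (n : ℝ) ^ (2 - δ) * (n : ℝ) ^ (2 - δ) * (n : ℝ) ^ (2 - δ) ≤
          ((#(A (j₁ x)) * #(B (j₁ x)) * (#(A (j₂ x)) * #(B (j₂ x))) * (#(A (j₃ x)) * #(B (j₃ x))) :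
            ℕ) : ℝ) :=
        cube_le_cast_mul₃ hY0 (hAB _) (hAB _) (hAB _)
      have h3 : (n : ℝ) ^ (3 * (2 - δ)) =
          (n : ℝ) ^ (2 - δ) * (n : ℝ) ^ (2 - δ) * (n : ℝ) ^ (2 - δ) := by
        rw [show (3 : ℝ) * (2 - δ) = (2 - δ) + (2 - δ) + (2 - δ) by ring, Real.rpow_add hn0,
          Real.rpow_add hn0]
      calc (n : ℝ) ^ ((2 - δ) * (2 + ε)) = ((n : ℝ) ^ (3 * (2 - δ))) ^ ((2 + ε) / 3) := by
            rw [← Real.rpow_mul hn0.le]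
            congr 1
            ring
        _ ≤ _ := by
            rw [h3]
            exact Real.rpow_le_rpow (by positivity) hle (by positivity)
    -- the exponent bookkeeping: 64 · n^{3(2+δ)} < 64 · |ι₀| · n^{(2-δ)(2+ε)}
    have key : (n : ℝ) ^ (3 * (2 + δ)) * 64 <
        64 * ((Fintype.card ι₀ : ℝ) * (n : ℝ) ^ ((2 - δ) * (2 + ε))) :=
      calc (n : ℝ) ^ (3 * (2 + δ)) * 64 < (n : ℝ) ^ (3 * (2 + δ)) * (n : ℝ) ^ ε :=
            mul_lt_mul_of_pos_left h64 (Real.rpow_pos_of_pos hn0 _)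
        _ = (n : ℝ) ^ (2 - δ) * (n : ℝ) ^ ((2 - δ) * (2 + ε)) := by
            rw [← Real.rpow_add hn0, ← Real.rpow_add hn0]
            congr 1
            linear_combination hδε
        _ ≤ 64 * (Fintype.card ι₀ : ℝ) * (n : ℝ) ^ ((2 - δ) * (2 + ε)) :=
            mul_le_mul_of_nonneg_right hcard (Real.rpow_nonneg hn0.le _)
        _ = 64 * ((Fintype.card ι₀ : ℝ) * (n : ℝ) ^ ((2 - δ) * (2 + ε))) := by ring
    have key' : (n : ℝ) ^ (3 * (2 + δ)) < (Fintype.card ι₀ : ℝ) * (n : ℝ) ^ ((2 - δ) * (2 + ε)) := by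
      linarith
    calc (Fintype.card (H × H × H) : ℝ)
          = (Fintype.card H : ℝ) * ((Fintype.card H : ℝ) * (Fintype.card H : ℝ)) := by
            rw [Fintype.card_prod, Fintype.card_prod]
            push_cast
            ring
      _ ≤ (n : ℝ) ^ (2 + δ) * ((n : ℝ) ^ (2 + δ) * (n : ℝ) ^ (2 + δ)) :=
            mul_le_mul hH (mul_le_mul hH hH (by positivity) hX0) (by positivity) hX0
      _ = (n : ℝ) ^ (3 * (2 + δ)) := by
            rw [← Real.rpow_add hn0, ← Real.rpow_add hn0]
            congr 1
            ring
      _ < (Fintype.card ι₀ : ℝ) * (n : ℝ) ^ ((2 - δ) * (2 + ε)) := key'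
      _ = ∑ _i : Fin (Fintype.card ι₀), (n : ℝ) ^ ((2 - δ) * (2 + ε)) := by
            rw [Finset.sum_const, Finset.card_univ, Fintype.card_fin, nsmul_eq_mul]
      _ ≤ _ := Finset.sum_le_sum fun i _ => hterm (e.symm i)

end Summit.MatrixMultiplication.MatrixMultiplication.Theorems.ThinPackings.PackingToCThesisK8
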